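import Summits.HodgeConjecture.HodgeConjecture.Theorems.Ring2DeformCMPointedPencils
import Summits.HodgeConjecture.HodgeConjecture.Theorems.Ring2DeformClassTargets
import Summits.HodgeConjecture.HodgeConjecture.Theorems.Ring2AbelianAllAndreLefschetz
import HarnessLib

/-!
# Ring 2 · route `deform`, XIII — CM-SPREADING ON COMPACT PENCILS: the pencil-type inputs next to which `HC_CM`
# is load-bearing in the kernel AND which André's §6.3 argument does not dominate in print; the universal one
# (CPS_CM, modulo Lemme 6.3.1) and the per-class one (CPS_∃, NO named fact), placed in the sub-cell's chain

HONEST FRAMING: research route conditional on HC_CM; not a corollary; Q11.4-sentence-2 already refuted in dim ≥ 3.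

Cell `pub-hodge-ring2`, seat `pub-hodge-ring2-deform` (gen 17; written next to the sub-cell `pub-hodge-ring2-ab-*`,
whose parts `Ring2AbelianAllAndreMinimal` / `Ring2AbelianAllAndreLefschetz` typed the candidates (3) `CMPointedPencilVHC`,
(4) `CMAnchoredTransport`, (L), (L∀), (5), (5∀) and the existential node (T∃) `CMAnchoredPencilTransport` for
"HC(all abelian varieties) ⟸ `HC_CM` + ONE named statement"). `HC_CM` = `Theses.RankFourFaces.CMAbelianHodge` is an
explicit BINDER `hCM` wherever it is used and is never cited as a fact; `HC_AV` =
`Theses.PadicSemiregularLift.HodgeAbelianVarieties`; the reduction item `Theses.RankFourFaces.CMToAbelian`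
(stmt-HodgeConjecture-16267) is OPEN and nothing here closes it. No statement minted in this cell is cited as a
fact: the two OPEN nodes below are `@[conjecture]` defs used only as hypotheses; André's Lemme 6.3.1 enters as the
literature seat's named fact `andre1996_cmAnchoredPencil` (a THEOREM in print, binder `h₂₁`). Nothing here is a new
case of the Hodge conjecture.

## What this part does

Every transport input typed so far on compact pencils of abelian varieties — (2) `CompactAbelianPencilVHC` (part IV),
(3) `CMPointedCompactPencilVHC` (part VI) = `AbelianAll.CMPointedPencilVHC` (the two typings coincide,
`cmPointedPencilVHC_iff_cmPointedCompactPencilVHC` below), R_{6.3.1} `CMAnchoredPencilVHC` (part VI),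
(4) `AbelianAll.CMAnchoredTransport` — has the premise "algebraic at ONE fibre" (any fibre, resp. a CM fibre), and
each is DOMINATED in print: granted Lemmes 6.3.2–6.3.3 it re-derives `HC_CM` (parts IV (D′), VI §D (2); sub-cell
part I honest column: take the 6.3.3 anchor `Eᴺ` with `E` CM, so the anchor fibre is a CM fibre where every Hodge
class is algebraic, and transport OUT of it reaches `X_{s_j} ~ B_j`). Part VII typed row U's input locally as
`CMSpreadingTo f n s₁`: premise "algebraic at EVERY CM fibre of `f`", whose conclusion AT a CM fibre is TAUTOLOGICAL
(`cmSpreadingTo_of_mem_cmLocus`). This part moves that premise onto the pencils: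

* §A NODES. `CMPointedPencilCMSpreading` (CPS_CM): for every compact abelian pencil `f` of relative dimension `d`
  with NONEMPTY CM locus and every `s₁`, `CMSpreadingTo f d s₁`. `CMAnchoredPencilCMSpreading` (CPS_∃): for every
  Hodge class `c` on every `A`, SOME pencil CM-anchored for `(A, p, c)` (the data of Lemme 6.3.1,
  `Andre1996.IsCMAnchoredPencilFor`) with `CMSpreadingTo f (2·dim A) s₁` for every `s₁`.
* §B ORDER (kernel, unconditional unless marked): (3) ⟹ (4) ⟹ CPS_CM; (T∃) ⟹ CPS_∃; CPS_CM ⟹ CPS_∃ and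
  `HC_AV ⟹ CPS_∃` granted `h₂₁`; `HC_AV ⟹ CPS_CM`; `HodgeConjecture ⟹` both (on path). So CPS_CM sits BELOW the
  sub-cell's `B_min` = (4) among the universal (pencil-uniform) inputs, and CPS_∃ below both (T∃) and CPS_CM: the
  weakest statement of the axis proved sufficient so far (no absolute minimality is claimed; REFEREE-AB F-ab-4).
* §C ROWS (`HC_CM` LOAD-BEARING). `HC_CM ∧ CPS_∃ ⟹ HC_AV` with NO named fact
  (`HC_AV_of_HC_CM_of_cmAnchoredPencilCMSpreading`): `HC_CM` makes the global section algebraic at EVERY CM fibre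
  (part II-b `forall_cmLocus_mem_algebraicClasses_of_HC_CM` — the only use of `hCM`), CPS_∃ concludes at the fibre
  `X_s` receiving `A`, pull back along `g`. Hence `HC_CM ∧ CPS_CM ⟹ HC_AV` granted Lemme 6.3.1; EXACTNESS
  `HC_AV ↔ HC_CM ∧ CPS_∃ ↔ HC_CM ∧ CPS_CM` (mod `h₂₁`); `CMToAbelian ⟸ CPS_∃` (no fact) and
  `CMToAbelian ↔ (HC_CM → CPS_CM) ↔ (HC_CM → CPS_∃)` (mod `h₂₁`); under `HC_CM` all pencil nodes coincide.
* §D WHY THE DOMINATION ARGUMENT DOES NOT REACH CPS_CM / CPS_∃ (kernel half of the honest column):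
  `cmPointedPencilCMSpreading_iff_offCM` — CPS_CM is EQUIVALENT to its restriction to target fibres OUTSIDE the CM
  locus. André's argument needs the transported conclusion AT the CM fibre `X_{s_j} ~ B_j` of the 6.3.3 pencil,
  which CM-spreading never delivers (there the premise contains the conclusion), and the typed junction `J₂₂⁺`
  (part VI) records algebraicity at the anchor `s₀` only, so it does not even feed the premise. CPS_∃ is moreover
  existential per class (its pencil is not the dominator's to choose), as the sub-cell observed for (T∃). No theorem
  in print known to this cell derives `HC_CM` from CPS_CM or CPS_∃: KIND 2 (complementary to `HC_CM`), like row U and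
  (T∃), unlike (2), (3), (4), (L), (L∀), (5), (5∀) (KIND 1). This is a statement about the ABSENCE of a printed
  argument, labelled as such, dated in RING2-MAP §deform (gen 17) D.58–D.59.

HONEST COLUMN. (a) CPS_CM / CPS_∃ are OPEN and have no print locator of their own: Grothendieck's invariant-cycle
statement [Abdulali 1994 (1.1); Charles–Schnell Conj. 11.3.1] on André's compact abelian pencils [André 1996 §6.3
footnote (2), Remarque 2] with the algebraic fibre replaced by the SET of CM fibres — the algebraic (not
absolute-Hodge) Principle B from CM points [Deligne 1982 Thm. 2.12 vs. Prop. 2.9], as row U; dated null for the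
statements themselves in RING2-MAP §deform (gen 17) D.59 (corpus fts + vec; galaxy). (b) CPS_CM is neither weaker
nor stronger than row U: U quantifies over quasi-projective CM-DENSE Mumford–Tate families (and needs fact #20 to
reach `HC_AV`), CPS_CM over CM-POINTED compact pencils (and needs Lemme 6.3.1); a 6.3.1 pencil is not CM-dense in
general (part IV honest column (4)). (c) The converses CPS_CM ⟹ (4), CPS_∃ ⟹ (T∃), CPS_∃ ⟹ CPS_CM are OPEN and
not claimed. (d) KIND verdicts are print-relative and isogeny-level, as everywhere on this axis.

References (keys of `references.bib`): Andre1996Motifs (Lemme 6.3.1 p. 31, Lemmes 6.3.2–6.3.3 and Remarque 2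
pp. 32–33), Abdulali1994FamiliesAV ((1.1) p. 1122, Lemma 6.2 p. 1131), CharlesSchnell2014Notes (Conj. 11.3.1,
Prop. 11.3.11, Cor. 11.3.6, Thm. 11.5.11), Deligne1982HodgeCycles (Thm. 2.12, Prop. 2.9, Prop. 6.1),
Milne2020HodgeClassesAV (arXiv:2010.08857, EXPOSITORY, UNREFEREED — Rem. 2–3 only, nothing used as a fact).
-/

noncomputable section

set_option linter.dupNamespace false

namespace Summit.HodgeConjecture.HodgeConjecture.Ring2.Deform

open CategoryTheory AlgebraicGeometry
open Literature.AlgebraicGeometry Literature.AlgebraicGeometry.Motives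
open Literature.AlgebraicGeometry.HodgeTheory
open Literature.AlgebraicGeometry.Milne1999 (IsOfCMType)
open Literature.AlgebraicGeometry.Andre1996 (andre1996_cmAnchoredPencil IsCMAnchoredPencilFor)
open Summit.HodgeConjecture.HodgeConjecture
open Summit.HodgeConjecture.HodgeConjecture.Theses
open Summit.HodgeConjecture.HodgeConjecture.Ring2.Hypotheses (AbelianSchemeVHC)
open Summit.HodgeConjecture.HodgeConjecture.Ring2.AbelianAll (CMPointedPencilVHC CMAnchoredTransport
  CMAnchoredPencilTransport mem_cmLocus_of_compactPencil cmAnchoredTransport_of_cmPointedPencilVHC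
  cmAnchoredTransport_of_HC_AV cmAnchoredPencilTransport_of_andre1996_of_HC_AV)
open Summit.HodgeConjecture.HodgeConjecture.Theorems.HodgeAbelianVarieties.Negative (iff_hodgeConjecture_restricted)

variable {𝒳 S : SchemeOver ℂ}

/-! ## §A The nodes: CM-spreading on CM-pointed compact pencils, universal and per class -/

/-- **CM-SPREADING ON CM-POINTED COMPACT PENCILS OF ABELIAN VARIETIES** (CPS_CM). For every compact pencil of
abelian varieties `f : 𝒳 ⟶ S` of relative dimension `d` (`Motives.IsCompactAbelianPencil f d`: André's «pinceau
compact») whose CM locus `cmLocus f d` (the points `s` with `𝒳_s ≅ A₀.X`, `A₀` of dimension `d` OF CM TYPE — the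
binder of `HC_CM`) is nonempty, and every `s₁ ∈ S(ℂ)`: a global class `W ∈ H^{2p}(𝒳(ℂ); ℂ)`, fibrewise rational
of type `(p,p)`, which is algebraic at EVERY CM fibre of `f`, is algebraic at `s₁` (`CMSpreadingTo f d s₁`,
part VII). OPEN; no print locator of its own (module docstring (a)); implied by (4), (3), `HC_AV`, `HodgeConjecture`
(§B). A HYPOTHESIS wherever used; never asserted.
[cite: Abdulali1994FamiliesAV, (1.1) (p. 1122)] [cite: Andre1996Motifs, §6.3 footnote (2) (p. 31) and Remarque 2 (p. 33)]
[cite: CharlesSchnell2014Notes, Conj. 11.3.1 and Prop. 11.3.11] [cite: Deligne1982HodgeCycles, Thm. 2.12 and Prop. 2.9]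
[status: open] -/
@[conjecture] def CMPointedPencilCMSpreading : Prop :=
  ∀ ⦃d : ℕ⦄ ⦃𝒳 S : SchemeOver ℂ⦄ (f : 𝒳 ⟶ S), IsCompactAbelianPencil f d → (cmLocus f d).Nonempty →
    ∀ s₁ : ComplexPoints S, CMSpreadingTo f d s₁

/-- **CM-SPREADING ALONG SOME CM-ANCHORED PENCIL, PER HODGE CLASS** (CPS_∃). For every complex abelian variety `A`
(smooth projective of dimension `dim A`), every `p` and every rational `(p,p)` class `c` on `A`, there is a compact
pencil `f : 𝒳 ⟶ S` CM-anchored for `(A, p, c)` in the sense of Lemme 6.3.1 (`Andre1996.IsCMAnchoredPencilFor`: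
relative dimension `2·dim A`, a CM fibre, a fibre `𝒳_s ≅ A₁.X` with `g : A ⟶ A₁` and a fibrewise-Hodge global
class `W` with `g^*(W|_{𝒳_s}) = q·c`, `q ≠ 0`) along which algebraicity spreads from the CM fibres to every
fibre (`CMSpreadingTo f (2·dim A) s₁` for all `s₁`). The sub-cell's (T∃) with "out of ONE CM fibre" weakened to
"out of ALL CM fibres"; implied by (T∃), and by CPS_CM / `HC_AV` granted Lemme 6.3.1 (§B); with `HC_CM` it gives
`HC_AV` with NO named fact (§C). OPEN; a HYPOTHESIS wherever used; never asserted.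
[cite: Andre1996Motifs, Lemme 6.3.1 (p. 31) and §6.3 a) (p. 33)] [cite: Abdulali1994FamiliesAV, Lemma 6.2 (p. 1131)]
[cite: Deligne1982HodgeCycles, Thm. 2.12 and Prop. 2.9] [status: open] -/
@[conjecture] def CMAnchoredPencilCMSpreading : Prop :=
  ∀ (A : AbelianVariety ℂ), IsSmoothProjective A.dim A.X →
    ∀ (p : ℕ) (c : complexBetti A.X (2 * p)), IsRationalClass c → IsOfHodgeType A.dim A.X (2 * p) p p c →
      ∃ (𝒳 S : SchemeOver ℂ) (f : 𝒳 ⟶ S), IsCMAnchoredPencilFor A p c f ∧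
        ∀ s₁ : ComplexPoints S, CMSpreadingTo f (2 * A.dim) s₁

/-- On a compact pencil, "CM-pointed" in part VI's sense (`∃ t A₀, A₀.X ≅ 𝒳_t ∧ IsOfCMType A₀`) and "`cmLocus f d`
nonempty" (part II-b's / the sub-cell's sense) are the same: the chart's dimension is forced
(`Andre1996.compactPencil_dim_eq_of_iso`, through `AbelianAll.mem_cmLocus_of_compactPencil`). [folklore] -/
theorem cmLocus_nonempty_iff_cmPointed {f : 𝒳 ⟶ S} {d : ℕ} (hf : IsCompactAbelianPencil f d) :
    (cmLocus f d).Nonempty ↔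
      ∃ (t : ComplexPoints S) (A₀ : AbelianVariety ℂ), Nonempty (A₀.X ≅ fiberOver f t) ∧ IsOfCMType A₀ :=
  ⟨fun ⟨t, A₀, he₀, _, hA₀⟩ ↦ ⟨t, A₀, he₀, hA₀⟩,
    fun ⟨t, _, ⟨e₀⟩, hA₀⟩ ↦ ⟨t, mem_cmLocus_of_compactPencil hf e₀ hA₀⟩⟩

/-- **The two typings of candidate (3) coincide**: the sub-cell's `AbelianAll.CMPointedPencilVHC` (CM locus
nonempty) ↔ part VI's `CMPointedCompactPencilVHC` (a CM chart at some point). [folklore] -/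
theorem cmPointedPencilVHC_iff_cmPointedCompactPencilVHC : CMPointedPencilVHC ↔ CMPointedCompactPencilVHC :=
  ⟨fun h _ _ _ f hf hpt ↦ h f hf ((cmLocus_nonempty_iff_cmPointed hf).2 hpt),
    fun h _ _ _ f hf hne ↦ h f hf ((cmLocus_nonempty_iff_cmPointed hf).1 hne)⟩

/-! ## §B Order (unconditional unless marked) and on-path lemmas -/

/-- **(4) ⟹ CPS_CM**: given algebraicity at all CM fibres of a CM-pointed pencil, pick one CM fibre and transport out
of it. The converse is OPEN. [cite: Andre1996Motifs, §6.3 a) (p. 33)] -/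
theorem cmPointedPencilCMSpreading_of_cmAnchoredTransport (hB : CMAnchoredTransport) : CMPointedPencilCMSpreading :=
  fun _ _ _ f hf hne s₁ p W hW hcm ↦ by
    obtain ⟨t, ht⟩ := hne
    exact hB f hf p W hW t ht (hcm t ht) s₁

/-- **(3) ⟹ CPS_CM** (part VI's typing; equivalently the sub-cell's, `cmPointedPencilVHC_iff_cmPointedCompactPencilVHC`):
(1.1) fed at any CM fibre (part VII `cmSpreadingTo_of_invariantCyclesHoldFor`). [cite: Abdulali1994FamiliesAV, (1.1) and Lemma 6.2] -/
theorem cmPointedPencilCMSpreading_of_cmPointedCompactPencilVHC (hV : CMPointedCompactPencilVHC) :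
    CMPointedPencilCMSpreading :=
  fun _ _ _ f hf hne s₁ ↦
    cmSpreadingTo_of_invariantCyclesHoldFor (hV f hf ((cmLocus_nonempty_iff_cmPointed hf).1 hne)) hne s₁

/-- `CompactAbelianPencilVHC ⟹ CPS_CM` (through part VI). [folklore] -/
theorem cmPointedPencilCMSpreading_of_compactAbelianPencilVHC (hV : CompactAbelianPencilVHC) :
    CMPointedPencilCMSpreading :=
  cmPointedPencilCMSpreading_of_cmPointedCompactPencilVHC (cmPointedCompactPencilVHC_of_compactAbelianPencilVHC hV)

/-- `AbelianSchemeVHC ⟹ CPS_CM` (through parts IV and VI). [folklore] -/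
theorem cmPointedPencilCMSpreading_of_abelianSchemeVHC (hV : AbelianSchemeVHC) : CMPointedPencilCMSpreading :=
  cmPointedPencilCMSpreading_of_cmPointedCompactPencilVHC (cmPointedCompactPencilVHC_of_abelianSchemeVHC hV)

/-- ON-PATH: `HC_AV ⟹ CPS_CM`. [cite: CharlesSchnell2014Notes, Cor. 11.3.6 (p. 494)] -/
theorem cmPointedPencilCMSpreading_of_HC_AV (h : PadicSemiregularLift.HodgeAbelianVarieties) :
    CMPointedPencilCMSpreading :=
  cmPointedPencilCMSpreading_of_cmPointedCompactPencilVHC (cmPointedCompactPencilVHC_of_HC_AV h)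

/-- ON-PATH (C6): `HodgeConjecture ⟹ CPS_CM`. [folklore] -/
theorem cmPointedPencilCMSpreading_of_hodgeConjecture (h : _root_.HodgeConjecture) : CMPointedPencilCMSpreading :=
  cmPointedPencilCMSpreading_of_HC_AV (HC_AV_of_hodgeConjecture h)

/-- **(T∃) ⟹ CPS_∃**: the 6.3.1 pencil of (T∃) has a CM fibre `t`; given algebraicity at all CM fibres, transport
out of `t`. The converse is OPEN. [cite: Andre1996Motifs, Lemme 6.3.1 (ii) (p. 31)] -/
theorem cmAnchoredPencilCMSpreading_of_cmAnchoredPencilTransport (hT : CMAnchoredPencilTransport) :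
    CMAnchoredPencilCMSpreading := by
  intro A hA p c hc hpp
  obtain ⟨𝒳, S, f, hanch, hT'⟩ := hT A hA p c hc hpp
  refine ⟨𝒳, S, f, hanch, fun s₁ p' W hW hcm ↦ ?_⟩
  obtain ⟨hf, _, t, _, _, A₀, _, _, _, _, _, _, ⟨e₀⟩, hA₀⟩ := hanch
  have ht : t ∈ cmLocus f (2 * A.dim) := mem_cmLocus_of_compactPencil hf e₀ hA₀
  exact hT' p' W hW t ht (hcm t ht) s₁

/-- **CPS_CM ⟹ CPS_∃, granted Lemme 6.3.1** (the pencil from `h₂₁`, CM-pointed by clause (ii)).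
[cite: Andre1996Motifs, Lemme 6.3.1 (p. 31)] -/
theorem cmAnchoredPencilCMSpreading_of_andre1996_of_cmPointedPencilCMSpreading (h₂₁ : andre1996_cmAnchoredPencil)
    (hS : CMPointedPencilCMSpreading) : CMAnchoredPencilCMSpreading := by
  intro A hA p c hc hpp
  obtain ⟨𝒳, S, f, hanch⟩ := h₂₁ A hA p c hc hpp
  refine ⟨𝒳, S, f, hanch, fun s₁ ↦ ?_⟩
  obtain ⟨hf, _, t, _, _, A₀, _, _, _, _, _, _, ⟨e₀⟩, hA₀⟩ := hanch
  exact hS f hf ⟨t, mem_cmLocus_of_compactPencil hf e₀ hA₀⟩ s₁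

/-- ON-PATH: `HC_AV ⟹ CPS_∃`, granted Lemme 6.3.1. [cite: Andre1996Motifs, Lemme 6.3.1 (p. 31)] -/
theorem cmAnchoredPencilCMSpreading_of_andre1996_of_HC_AV (h₂₁ : andre1996_cmAnchoredPencil)
    (h : PadicSemiregularLift.HodgeAbelianVarieties) : CMAnchoredPencilCMSpreading :=
  cmAnchoredPencilCMSpreading_of_andre1996_of_cmPointedPencilCMSpreading h₂₁ (cmPointedPencilCMSpreading_of_HC_AV h)

/-- ON-PATH: `HodgeConjecture ⟹ CPS_∃`, granted Lemme 6.3.1. [folklore] -/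
theorem cmAnchoredPencilCMSpreading_of_andre1996_of_hodgeConjecture (h₂₁ : andre1996_cmAnchoredPencil)
    (h : _root_.HodgeConjecture) : CMAnchoredPencilCMSpreading :=
  cmAnchoredPencilCMSpreading_of_andre1996_of_HC_AV h₂₁ (HC_AV_of_hodgeConjecture h)

/-! ## §C The rows: `HC_CM` load-bearing — with NO named fact for CPS_∃, granted Lemme 6.3.1 for CPS_CM -/

/-- **`HC_CM ∧ CPS_∃ ⟹` Hodge for every complex abelian variety — NO named fact** (variety-by-variety form).
`HC_CM` makes the section of the CPS_∃ pencil algebraic at EVERY CM fibre (`forall_cmLocus_mem_algebraicClasses_of_HC_CM`,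
part II-b — the only use of `hCM`); CM-spreading concludes at the fibre `X_s` receiving `A`; `e₁`, `g` bring the
class back to `q·c`, `q ≠ 0` (the last lines of part VI `hodgeConjecture_abelian_of_cm_of_cmAnchoredPencilVHC`).
[cite: Andre1996Motifs, §6.3 a) (p. 33)] [cite: Abdulali1994FamiliesAV, Lemma 6.2 (p. 1131)] -/
theorem hodgeConjecture_abelian_of_HC_CM_of_cmAnchoredPencilCMSpreading (hCM : RankFourFaces.CMAbelianHodge)
    (hT : CMAnchoredPencilCMSpreading) :
    ∀ A : AbelianVariety ℂ, IsSmoothProjective A.dim A.X → HodgeConjectureFor A.dim A.X := by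
  intro A hA
  refine (hodgeConjectureFor_iff_of_isSmoothProjective nonempty_hodgeModel_holds hA).2 ?_
  intro p c hc hpp
  obtain ⟨𝒳, S, f, ⟨_, s, _, W, A₁, _, e₁, g, q, hW, hq, hgc, _, _⟩, hS⟩ := hT A hA p c hc hpp
  -- `HC_CM` at every CM fibre, then CM-spreading to the fibre `s`
  have h₁ : complexBetti.map (fiberι f s) (2 * p) W ∈ algebraicClasses (fiberOver f s) p :=
    hS s p W hW (forall_cmLocus_mem_algebraicClasses_of_HC_CM hCM f W hW)
  -- across `e₁` and back along `g`
  have h₂ : complexBetti.map e₁.hom (2 * p) (complexBetti.map (fiberι f s) (2 * p) W) ∈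
      algebraicClasses A₁.X p :=
    (mem_algebraicClasses_map_iff_of_iso e₁).2 h₁
  have h₃ : (q : ℂ) • c ∈ algebraicClasses A.X p := by
    rw [← hgc]
    exact map_mem_algebraicClasses_of_abelianVariety hA A₁ g.hom.hom.hom h₂
  exact (Submodule.smul_mem_iff _ (Rat.cast_ne_zero.2 hq)).1 h₃

/-- **ROW P∃: `HC_CM ∧ CPS_∃ ⟹ HC_AV` — NO named fact**; `hCM` consumed BY NAME at the CM fibres only.
[cite: Andre1996Motifs, §6.3 a) (p. 33)] [cite: Abdulali1994FamiliesAV, Lemma 6.2 (p. 1131)] -/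
theorem HC_AV_of_HC_CM_of_cmAnchoredPencilCMSpreading (hCM : RankFourFaces.CMAbelianHodge)
    (hT : CMAnchoredPencilCMSpreading) : PadicSemiregularLift.HodgeAbelianVarieties :=
  iff_hodgeConjecture_restricted.2 (hodgeConjecture_abelian_of_HC_CM_of_cmAnchoredPencilCMSpreading hCM hT)

/-- **ROW P: `HC_CM ∧ CPS_CM ⟹ HC_AV`, granted Lemme 6.3.1** — the weakest universal pencil-type transport input of
the axis proved sufficient, and one André's §6.3 argument does not dominate (§D, module docstring).
[cite: Andre1996Motifs, Lemme 6.3.1 (p. 31)] [cite: Abdulali1994FamiliesAV, Lemma 6.2 (p. 1131)] -/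
theorem HC_AV_of_andre1996_of_HC_CM_of_cmPointedPencilCMSpreading (h₂₁ : andre1996_cmAnchoredPencil)
    (hCM : RankFourFaces.CMAbelianHodge) (hS : CMPointedPencilCMSpreading) :
    PadicSemiregularLift.HodgeAbelianVarieties :=
  HC_AV_of_HC_CM_of_cmAnchoredPencilCMSpreading hCM
    (cmAnchoredPencilCMSpreading_of_andre1996_of_cmPointedPencilCMSpreading h₂₁ hS)

/-- **EXACTNESS**: granted Lemme 6.3.1, `HC_AV ↔ HC_CM ∧ CPS_∃` and `HC_AV ↔ HC_CM ∧ CPS_CM` — both factors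
genuine in the kernel; in print `HC_CM` is NOT known to follow from either node (contrast part IV (E₃′), VI §D (2)).
[cite: Andre1996Motifs, Lemme 6.3.1 and Remarque 2 (pp. 31–33)] [cite: CharlesSchnell2014Notes, Cor. 11.3.6] -/
theorem HC_AV_iff_HC_CM_and_cmSpreadingNodes_of_andre1996 (h₂₁ : andre1996_cmAnchoredPencil) :
    (PadicSemiregularLift.HodgeAbelianVarieties ↔ (RankFourFaces.CMAbelianHodge ∧ CMAnchoredPencilCMSpreading)) ∧
      (PadicSemiregularLift.HodgeAbelianVarieties ↔ (RankFourFaces.CMAbelianHodge ∧ CMPointedPencilCMSpreading)) :=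
  ⟨⟨fun h ↦ ⟨HC_CM_of_HC_AV h, cmAnchoredPencilCMSpreading_of_andre1996_of_HC_AV h₂₁ h⟩,
      fun h ↦ HC_AV_of_HC_CM_of_cmAnchoredPencilCMSpreading h.1 h.2⟩,
    ⟨fun h ↦ ⟨HC_CM_of_HC_AV h, cmPointedPencilCMSpreading_of_HC_AV h⟩,
      fun h ↦ HC_AV_of_andre1996_of_HC_CM_of_cmPointedPencilCMSpreading h₂₁ h.1 h.2⟩⟩

/-- **The item from CPS_∃ alone — NO named fact**: `CPS_∃ ⟹ CMToAbelian` (a typed conditional TOWARD the open item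
stmt-HodgeConjecture-16267; nothing closes it). [cite: Andre1996Motifs, §6.3 a) (p. 33)] -/
theorem cmToAbelian_of_cmAnchoredPencilCMSpreading (hT : CMAnchoredPencilCMSpreading) : RankFourFaces.CMToAbelian :=
  fun hCM A _ ↦ HC_AV_of_HC_CM_of_cmAnchoredPencilCMSpreading hCM hT A

/-- **`CMToAbelian ↔ (HC_CM → CPS_CM) ↔ (HC_CM → CPS_∃)`**, granted Lemme 6.3.1: the open reduction item is
EQUIVALENT to "under `HC_CM`, CM-spreading on CM-pointed compact abelian pencils" in either form.
[cite: Andre1996Motifs, Lemme 6.3.1 (p. 31)] [cite: CharlesSchnell2014Notes, Conj. 11.3.1 and Cor. 11.3.6] -/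
theorem cmToAbelian_iff_HC_CM_imp_cmSpreadingNodes_of_andre1996 (h₂₁ : andre1996_cmAnchoredPencil) :
    (RankFourFaces.CMToAbelian ↔ (RankFourFaces.CMAbelianHodge → CMPointedPencilCMSpreading)) ∧
      (RankFourFaces.CMToAbelian ↔ (RankFourFaces.CMAbelianHodge → CMAnchoredPencilCMSpreading)) := by
  refine ⟨⟨fun h hCM ↦ ?_, fun h hCM A _ ↦ ?_⟩, ⟨fun h hCM ↦ ?_, fun h hCM A _ ↦ ?_⟩⟩
  · exact cmPointedPencilCMSpreading_of_HC_AV (Hypotheses.hc_av_iff_hc_cm_and_cmToAbelian.2 ⟨hCM, h⟩)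
  · exact HC_AV_of_andre1996_of_HC_CM_of_cmPointedPencilCMSpreading h₂₁ hCM (h hCM) A
  · exact cmAnchoredPencilCMSpreading_of_andre1996_of_HC_AV h₂₁
      (Hypotheses.hc_av_iff_hc_cm_and_cmToAbelian.2 ⟨hCM, h⟩)
  · exact HC_AV_of_HC_CM_of_cmAnchoredPencilCMSpreading hCM (h hCM) A

/-- **Under `HC_CM` all pencil nodes coincide** (granted Lemme 6.3.1; every arrow passes through `HC_AV`):
CPS_CM ↔ (4) ↔ (3) and CPS_∃ ↔ (T∃) ↔ CPS_CM. [cite: Andre1996Motifs, Lemme 6.3.1 and Remarque 2 (pp. 31–33)] -/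
theorem cmSpreadingNodes_iff_of_andre1996_of_HC_CM (h₂₁ : andre1996_cmAnchoredPencil)
    (hCM : RankFourFaces.CMAbelianHodge) :
    (CMPointedPencilCMSpreading ↔ CMAnchoredTransport) ∧ (CMPointedPencilCMSpreading ↔ CMPointedCompactPencilVHC) ∧
      (CMAnchoredPencilCMSpreading ↔ CMAnchoredPencilTransport) ∧
      (CMAnchoredPencilCMSpreading ↔ CMPointedPencilCMSpreading) := by
  have hS : CMPointedPencilCMSpreading → PadicSemiregularLift.HodgeAbelianVarieties :=
    HC_AV_of_andre1996_of_HC_CM_of_cmPointedPencilCMSpreading h₂₁ hCM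
  have hT : CMAnchoredPencilCMSpreading → PadicSemiregularLift.HodgeAbelianVarieties :=
    HC_AV_of_HC_CM_of_cmAnchoredPencilCMSpreading hCM
  exact ⟨⟨fun h ↦ cmAnchoredTransport_of_HC_AV (hS h), cmPointedPencilCMSpreading_of_cmAnchoredTransport⟩,
    ⟨fun h ↦ cmPointedCompactPencilVHC_of_HC_AV (hS h), cmPointedPencilCMSpreading_of_cmPointedCompactPencilVHC⟩,
    ⟨fun h ↦ cmAnchoredPencilTransport_of_andre1996_of_HC_AV h₂₁ (hT h),
      cmAnchoredPencilCMSpreading_of_cmAnchoredPencilTransport⟩,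
    ⟨fun h ↦ cmPointedPencilCMSpreading_of_HC_AV (hT h),
      cmAnchoredPencilCMSpreading_of_andre1996_of_cmPointedPencilCMSpreading h₂₁⟩⟩

/-- ON-PATH for §C: `HC_CM → CPS_CM` follows from the Hodge conjecture. [folklore] -/
theorem HC_CM_imp_cmPointedPencilCMSpreading_of_hodgeConjecture (h : _root_.HodgeConjecture) :
    RankFourFaces.CMAbelianHodge → CMPointedPencilCMSpreading :=
  fun _ ↦ cmPointedPencilCMSpreading_of_hodgeConjecture h

/-! ## §D Why André's domination argument does not reach these nodes (the kernel half of the honest column) -/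

/-- **CPS_CM never concludes anything at a CM fibre**: it is EQUIVALENT to its restriction to target fibres outside
the CM locus (at `s₁ ∈ cmLocus f d` the premise contains the conclusion, part VII `cmSpreadingTo_of_mem_cmLocus`).
Lemmes 6.3.2–6.3.3 derive `HC_CM` from algebraicity AT the CM fibre `X_{s_j} ~ B_j` of the 6.3.3 pencil (parts
IV (D′) / VI §D (2); sub-cell part I, honest column), so that argument cannot be run from CPS_CM.
[cite: Andre1996Motifs, Lemmes 6.3.2–6.3.3 (pp. 32–33)] -/
theorem cmPointedPencilCMSpreading_iff_offCM :
    CMPointedPencilCMSpreading ↔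
      ∀ ⦃d : ℕ⦄ ⦃𝒳 S : SchemeOver ℂ⦄ (f : 𝒳 ⟶ S), IsCompactAbelianPencil f d → (cmLocus f d).Nonempty →
        ∀ s₁ : ComplexPoints S, s₁ ∉ cmLocus f d → CMSpreadingTo f d s₁ := by
  refine ⟨fun h d 𝒳 S f hf hne s₁ _ ↦ h f hf hne s₁, fun h d 𝒳 S f hf hne s₁ ↦ ?_⟩
  by_cases hs : s₁ ∈ cmLocus f d
  · exact cmSpreadingTo_of_mem_cmLocus hs
  · exact h f hf hne s₁ hs

/- CONTRAST (plain comment; the kernel rows live in parts IV/VI and in the sub-cell's part I). What the typed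
junction `J₂₂⁺` of part VI (Lemmes 6.3.2–6.3.3 with the CM-fibre clause retained) gives toward the PREMISE of
CPS_CM: nothing — it records algebraicity of the extended class at the ANCHOR fibre `s₀` only
(`IsAlgebraicallyAnchoredPencilFor … ∧ ∃ t, CM fibre`), where (1.1), not CM-spreading, is what concludes
(`IsAlgebraicallyAnchoredPencilFor.mem_algebraicClasses`). Hence the domination rows
`HC_CM_of_junction_of_cmPointedCompactPencilVHC` / `HC_CM_of_fact22_of_compactAbelianPencilVHC` /
`AbelianAll.HC_CM_of_andre1996_of_algebraicFixedPart` have NO analogue for CPS_CM or CPS_∃ in this file, and none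
is claimed either way: "CPS_CM ⟹ HC_CM" is neither proved nor refuted here; its absence from print is recorded,
dated, in RING2-MAP §deform (gen 17) D.58–D.59. -/

end Summit.HodgeConjecture.HodgeConjecture.Ring2.Deform

end
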